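import Summits.CriticalPhenomena.PercolationContinuityZ3.Theorems.Transplant.RationalHalfSlabDesign
import HarnessLib

/-!
# The wedge-slab `{x ∈ S_k | x₁ ≥ 0, γ ≤ x₁ + βx₂}` (`0 ≤ β ≤ 1`, real): a half-plane of real slope cut by the half-slab `{x₁ ≥ 0}` — the station design

builds on p205010 (kernel theorem, internal audit signed; external expert review pending) — NOT used in this file.
Lane `prim-bschramm`, seat `prim-bschramm-p2` (gen 23; class C1b, METHOD = input substitution; memo `HOME/bschramm/P2-LATTICES.md` §79);
helper file (`--supports stmt-CriticalPhenomena-4575 --as helper`).  Family B of the OBTUSE-SECTOR programme: the swap `x₁ ↔ x₂` of this domain with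
`γ = 0` is the axis-attached planar sector of aperture `90° + arctan(1/β)·…` — precisely, `{x₂ ≥ 0} ∩ {βx₁ + x₂ ≥ 0}` = the sector between direction `0°`
and direction `180° − arctan β`, i.e. every obtuse aperture in `[135°, 180°)` (`β ∈ (0,1]`); `β = 0` is the quarter-slab.  The design is that of
`RealHalfSlabDesign` VERBATIM (top / right / left faces, `Ω = (0, 4N+4, −(3N+3))`, `Z = 3N+3`, `T = 7N+7`, `M = k+7N+7`, thin arms): every region used
there has `x₁ ≥ 0` (sweep `x₁ ≥ 4N+4`; arms start at `x₁ = u₁ ≥ 0` or `N+1` and go up), and the bottom face is excluded by `x₁ ≥ 0` itself — so no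
sign condition on `γ` is needed (`N ≥ k + 1 + ⌈γ⌉₊`).
* `mem_wdgB_iff`, `wdgB_cyl`, **`wdgB_innerBdry`**, `wdgB_station_props`, **`wdgB_vertex_design`**.  Sequel `WedgeSlabBRow`.
[cite: AizenmanChayesChayesFrohlichRusso1983, §4 Thm 4.4, Lemma 4.2 (a), Lemma 4.3] [cite: ChayesChayes1986Wedges, Thm. 1]
[cite: DuminilCopinSidoraviciusTassion2016, Thm. 1 and §2] -/

noncomputable section

namespace Summit.CriticalPhenomena.PercolationContinuityZ3.Theorems.Transplant

namespace WedgeSlabB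

open MeasureTheory Literature.Probability.Percolation Literature.Probability.LatticeModels SimpleGraph HSU OrthantUniq HalfSlabUniq
  ConeSlabUniq ThinConeSlab RationalHalfSlab Filter
open scoped Classical Topology

variable {k : ℕ} {N : ℕ} {β γ : ℝ}

/-! ## §1 The half-slab of real slope: `{x ∈ S_k | γ ≤ x₁ + βx₂}` -/

/-- Membership. [folklore] -/
theorem mem_wdgB_iff {x : Site 3} :
    x ∈ {x : Site 3 | x ∈ slab 3 k ∧ (0 ≤ x 1 ∧ γ ≤ (x 1 : ℝ) + β * (x 2 : ℝ))} ↔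
      (0 ≤ x 0 ∧ x 0 ≤ (k : ℤ)) ∧ (0 ≤ x 1 ∧ γ ≤ (x 1 : ℝ) + β * (x 2 : ℝ)) := Iff.rfl

/-- The domain is cylindrical. [folklore] -/
theorem wdgB_cyl : ∀ x ∈ {x : Site 3 | x ∈ slab 3 k ∧ (0 ≤ x 1 ∧ γ ≤ (x 1 : ℝ) + β * (x 2 : ℝ))}, ∀ y ∈ slab 3 k, y 1 = x 1 → y 2 = x 2 →
    y ∈ {x : Site 3 | x ∈ slab 3 k ∧ (0 ≤ x 1 ∧ γ ≤ (x 1 : ℝ) + β * (x 2 : ℝ))} := by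
  intro x hx y hy h1 h2
  exact ⟨hy, by rw [h1, h2]; exact hx.2⟩

/-- The domain lies in the slab. [folklore] -/
theorem wdgB_subset_slab : {x : Site 3 | x ∈ slab 3 k ∧ (0 ≤ x 1 ∧ γ ≤ (x 1 : ℝ) + β * (x 2 : ℝ))} ⊆ slab 3 k := fun _ hx => hx.1

/-- `N ≥ k + 1 + ⌈γ⌉₊` gives `γ < N + 1` (in `ℝ`) and `k + 1 ≤ N`. [folklore] -/
theorem wdgB_bounds_of_N0 (hN : k + 1 + ⌈γ⌉₊ ≤ N) : γ < (N : ℝ) + 1 ∧ k + 1 ≤ N := by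
  refine ⟨?_, by omega⟩
  have h1 : γ ≤ (⌈γ⌉₊ : ℝ) := Nat.le_ceil γ
  have h2 : ((k + 1 + ⌈γ⌉₊ : ℕ) : ℝ) ≤ N := by exact_mod_cast hN
  push_cast at h2
  linarith

/-- **Classification of the inner boundary of `[-N,N]³` in `{x ∈ S_k | γ ≤ x₁ + βx₂}`** (`N ≥ k + 1 + ⌈γ⌉₊`): top face `u₁ = N`, right face `u₂ = N`, or left face
`u₂ = −N` with `γ ≤ u₁ − β(N+1)`; NEVER the bottom face (`u₁ ≥ 0 > −N`).
[cite: AizenmanChayesChayesFrohlichRusso1983, §4 (4.26)] -/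
theorem wdgB_innerBdry (hN : k + 1 + ⌈γ⌉₊ ≤ N) {u : Site 3} (hu : u ∈ boxSet 3 N)
    (hw : ∃ w, w ∉ boxSet 3 N ∧ (withinGraph (zdGraph 3) {x : Site 3 | x ∈ slab 3 k ∧ (0 ≤ x 1 ∧ γ ≤ (x 1 : ℝ) + β * (x 2 : ℝ))}).Adj u w) :
    u ∈ {x : Site 3 | x ∈ slab 3 k ∧ (0 ≤ x 1 ∧ γ ≤ (x 1 : ℝ) + β * (x 2 : ℝ))} ∧
      (u 1 = N ∨ u 2 = N ∨ (u 2 = -(N : ℤ) ∧ γ ≤ (u 1 : ℝ) - β * ((N : ℝ) + 1))) := by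
  obtain ⟨-, hkN⟩ := wdgB_bounds_of_N0 hN
  obtain ⟨huD, hface⟩ := innerBdry_faces wdgB_subset_slab hkN hu hw
  refine ⟨huD, ?_⟩
  have hub := mem_boxSet_iff.1 hu
  have hu1 := hub 1; have hu2 := hub 2
  rcases hface with ⟨h, -⟩ | ⟨h, -⟩ | ⟨h, hD⟩ | ⟨h, hD⟩
  · exact Or.inl h
  · exact Or.inr (Or.inl h)
  · right; right
    refine ⟨h, ?_⟩
    have h2 := (mem_wdgB_iff.1 hD).2.2
    simp only [Pi.sub_apply, Pi.single_eq_same, Pi.single_eq_of_ne (show (1 : Fin 3) ≠ 2 by decide), sub_zero] at h2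
    rw [h] at h2; push_cast at h2; linarith
  · exfalso
    have h2 := (mem_wdgB_iff.1 huD).2.1
    omega

/-! ## §2 The direction-independent design -/

/-- **The station's region**: `Ω = (0, 4N+4, −(3N+3))`, `Z = 3N+3`, `T = 7N+7` (`N ≥ k + 1 + ⌈γ⌉₊`, `0 ≤ β ≤ 1`): inside the domain
(`x₁ + βx₂ ≥ 4N+4 − β(3N+3) ≥ N+1 > γ`), off the box, below `T`. [folklore] -/
theorem wdgB_station_props (hβ0 : 0 ≤ β) (hβ1 : β ≤ 1) (hN : k + 1 + ⌈γ⌉₊ ≤ N) {x : Site 3}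
    (hx : x ∈ shallowReg k ![0, 4 * (N : ℤ) + 4, -(3 * (N : ℤ) + 3)] (3 * (N : ℤ) + 3)) :
    x ∈ {x : Site 3 | x ∈ slab 3 k ∧ (0 ≤ x 1 ∧ γ ≤ (x 1 : ℝ) + β * (x 2 : ℝ))} ∧ x ∉ boxSet 3 N ∧ x 1 ≤ 7 * (N : ℤ) + 7 := by
  obtain ⟨hγN, -⟩ := wdgB_bounds_of_N0 hN
  obtain ⟨h0, h1, h2, h3, hZ⟩ := shallowReg_props hx
  simp only [Matrix.cons_val_one, Matrix.cons_val_zero, Matrix.cons_val] at h1 h2 h3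
  have h1r : 4 * (N : ℝ) + 4 ≤ (x 1 : ℝ) := by exact_mod_cast h1
  have h3r : -(3 * (N : ℝ) + 3) ≤ (x 2 : ℝ) := by exact_mod_cast h3
  have e2 : β * (-(3 * (N : ℝ) + 3)) ≤ β * (x 2 : ℝ) := mul_le_mul_of_nonneg_left h3r hβ0
  have e3 : β * (3 * (N : ℝ) + 3) ≤ 1 * (3 * (N : ℝ) + 3) := mul_le_mul_of_nonneg_right hβ1 (by positivity)
  refine ⟨⟨h0, by omega, by linarith⟩, not_mem_boxSet_of_lt (j := 1) (by rw [abs_of_nonneg (by omega)]; omega), by omega⟩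

/-- **The design at an inner-boundary vertex of `{x ∈ S_k | γ ≤ x₁ + βx₂}`** (`0 ≤ β ≤ 1`, any `γ`, `N ≥ k + 1 + ⌈γ⌉₊`; `α₄` a thin-arm bound and `A` a
slab arm kit at `p'`): an increasing event, measurable, determined by the edges of `[-M,M]³` (`M = k + 7N + 7`), of `P_{p'} ≥ α₄·α`, on which `≤ k + 2`
extra open edges join `u` to the station `Ω = (0, 4N+4, −(3N+3))` through open exterior steps of the domain.
[cite: AizenmanChayesChayesFrohlichRusso1983, §4 Cor. to Lemma 4.3, Lemma 4.2 (a)] -/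
theorem wdgB_vertex_design (hβ0 : 0 ≤ β) (hβ1 : β ≤ 1) (hN : k + 1 + ⌈γ⌉₊ ≤ N)
    {p' : unitInterval} (A : SlabArmKit k p') {α₄ : ℝ} (hα₄ : 0 < α₄)
    (harm₄ : ∀ σ : ℤ, (σ = 1 ∨ σ = -1) → ∀ b : Site 3, b ∈ slab 3 k →
      α₄ ≤ (bondPercolation (zdGraph 3) p').real (percolatesVia (withinGraph (zdGraph 3) (steepSet4 k σ b)) b))
    {u : Site 3} (hu : u ∈ boxSet 3 N)
    (hw : ∃ w, w ∉ boxSet 3 N ∧ (withinGraph (zdGraph 3) {x : Site 3 | x ∈ slab 3 k ∧ (0 ≤ x 1 ∧ γ ≤ (x 1 : ℝ) + β * (x 2 : ℝ))}).Adj u w) :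
    ∃ E : Set (BondConfig (Site 3)), IsUpperSet E ∧ MeasurableSet E ∧ DeterminedBy E ↑(edgesIn (zdGraph 3) (box 3 (k + 7 * N + 7))) ∧
      α₄ * A.α ≤ (bondPercolation (zdGraph 3) p').real E ∧
      ∀ ω ∈ E, ∃ F : Finset (Sym2 (Site 3)), F ⊆ edgesIn (zdGraph 3) (box 3 (k + 7 * N + 7)) ∧ F.card ≤ k + 2 ∧
        ω ∪ ↑F ∈ openConnVia (starGraph (withinGraph (zdGraph 3) {x : Site 3 | x ∈ slab 3 k ∧ (0 ≤ x 1 ∧ γ ≤ (x 1 : ℝ) + β * (x 2 : ℝ))}) Set.univ (boxSet 3 N)) u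
          ![0, 4 * (N : ℤ) + 4, -(3 * (N : ℤ) + 3)] := by
  obtain ⟨huP, hface⟩ := wdgB_innerBdry hN hu hw
  obtain ⟨hu0, hu1nn, huP'⟩ := (mem_wdgB_iff (k := k)).1 huP
  obtain ⟨-, hkN⟩ := wdgB_bounds_of_N0 hN
  have hub := mem_boxSet_iff.1 hu
  have hu1 := hub 1; have hu2 := hub 2
  set Ω : Site 3 := ![0, 4 * (N : ℤ) + 4, -(3 * (N : ℤ) + 3)] with hΩ_def
  have hΩ0 : Ω 0 = 0 := by simp [hΩ_def]
  have hΩ1 : Ω 1 = 4 * (N : ℤ) + 4 := by simp [hΩ_def]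
  have hΩ2 : Ω 2 = -(3 * (N : ℤ) + 3) := by simp [hΩ_def]
  have hΩslab : Ω ∈ slab 3 k := by show 0 ≤ Ω 0 ∧ Ω 0 ≤ (k : ℤ); rw [hΩ0]; exact ⟨le_rfl, by positivity⟩
  have hH : ∀ x ∈ shallowReg k Ω (3 * (N : ℤ) + 3), x ∈ {x : Site 3 | x ∈ slab 3 k ∧ (0 ≤ x 1 ∧ γ ≤ (x 1 : ℝ) + β * (x 2 : ℝ))} ∧ x ∉ boxSet 3 N ∧
      x 1 ≤ 7 * (N : ℤ) + 7 := fun x hx => wdgB_station_props hβ0 hβ1 hN hx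
  have hwinH : ∀ x ∈ shallowReg k Ω (3 * (N : ℤ) + 3), ∀ j, |x j| ≤ (k + 7 * N + 7 : ℕ) := by
    intro x hx j
    obtain ⟨h0, h1, h2, h3, hZ⟩ := shallowReg_props hx
    rw [hΩ1] at h1 h2; rw [hΩ2] at h2 h3
    fin_cases j <;> rw [abs_le] <;> push_cast <;> constructor <;> omega
  -- generic packaging: apex `b ∈ S_k` with `-N ≤ b₁ ≤ N+1`, `|b₂| ≤ N+1`, its truncated thin steep region in the domain off the box, an escape of ≤ 2 edges
  have pack : ∀ {σ : ℤ} (_ : σ = 1 ∨ σ = -1) {b : Site 3} (_ : b ∈ slab 3 k) (_ : -(N : ℤ) ≤ b 1) (_ : b 1 ≤ (N : ℤ) + 1) (_ : |b 2| ≤ (N : ℤ) + 1)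
      (_ : ∀ x ∈ steepSet4 k σ b ∩ {x | x 1 ≤ 7 * (N : ℤ) + 7}, x ∈ {x : Site 3 | x ∈ slab 3 k ∧ (0 ≤ x 1 ∧ γ ≤ (x 1 : ℝ) + β * (x 2 : ℝ))} ∧ x ∉ boxSet 3 N)
      (Esc : Finset (Sym2 (Site 3))) (_ : Esc ⊆ edgesIn (zdGraph 3) (box 3 (k + 7 * N + 7))) (_ : Esc.card ≤ 2)
      (_ : ∀ (ω : BondConfig (Site 3)) (F : Finset (Sym2 (Site 3))), Esc ⊆ F →
        ω ∪ ↑F ∈ openConnVia (starGraph (withinGraph (zdGraph 3) {x : Site 3 | x ∈ slab 3 k ∧ (0 ≤ x 1 ∧ γ ≤ (x 1 : ℝ) + β * (x 2 : ℝ))}) Set.univ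
          (boxSet 3 N)) b Ω →
        ω ∪ ↑F ∈ openConnVia (starGraph (withinGraph (zdGraph 3) {x : Site 3 | x ∈ slab 3 k ∧ (0 ≤ x 1 ∧ γ ≤ (x 1 : ℝ) + β * (x 2 : ℝ))}) Set.univ
          (boxSet 3 N)) u Ω),
      ∃ E : Set (BondConfig (Site 3)), IsUpperSet E ∧ MeasurableSet E ∧ DeterminedBy E ↑(edgesIn (zdGraph 3) (box 3 (k + 7 * N + 7))) ∧
        α₄ * A.α ≤ (bondPercolation (zdGraph 3) p').real E ∧
        ∀ ω ∈ E, ∃ F : Finset (Sym2 (Site 3)), F ⊆ edgesIn (zdGraph 3) (box 3 (k + 7 * N + 7)) ∧ F.card ≤ k + 2 ∧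
          ω ∪ ↑F ∈ openConnVia (starGraph (withinGraph (zdGraph 3) {x : Site 3 | x ∈ slab 3 k ∧ (0 ≤ x 1 ∧ γ ≤ (x 1 : ℝ) + β * (x 2 : ℝ))}) Set.univ
            (boxSet 3 N)) u Ω := by
    intro σ hσ b hb hb1lo hb1hi hb2 hSD Esc hEsc hEscc hEscMove
    have hb2' := abs_le.1 hb2
    set T : ℤ := 7 * (N : ℤ) + 7 with hT
    set S : Set (Site 3) := steepSet4 k σ b ∩ {x | x 1 ≤ T} with hS_def
    have hbS : b ∈ S := ⟨self_mem_steepSet4 hb, by show b 1 ≤ T; omega⟩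
    have hSprops : ∀ x ∈ S, (0 ≤ x 0 ∧ x 0 ≤ (k : ℤ)) ∧ b 1 ≤ x 1 ∧ x 1 ≤ T ∧ 0 ≤ σ * (x 2 - b 2) ∧ σ * (x 2 - b 2) ≤ 2 * (N : ℤ) + 1 := by
      rintro x ⟨⟨h0, h1, h2⟩, hxT⟩
      have hxT' : x 1 ≤ T := hxT
      exact ⟨h0, by omega, hxT', h1, by omega⟩
    have hSz : ∀ x ∈ S, Ω 2 ≤ x 2 ∧ x 2 ≤ 3 * (N : ℤ) + 3 := by
      intro x hx
      obtain ⟨-, -, -, h1, h2⟩ := hSprops x hx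
      rw [hΩ2]
      rcases hσ with rfl | rfl
      · rw [one_mul] at h1 h2; constructor <;> omega
      · rw [neg_one_mul] at h1 h2; constructor <;> omega
    have hwinS : ∀ x ∈ S, ∀ j, |x j| ≤ (k + 7 * N + 7 : ℕ) := by
      intro x hx j
      obtain ⟨h0, h1, h2, -, -⟩ := hSprops x hx
      obtain ⟨h3, h4⟩ := hSz x hx
      rw [hΩ2] at h3
      fin_cases j <;> rw [abs_le] <;> push_cast <;> constructor <;> omega
    have hM : ∀ x ∈ S ∪ shallowReg k Ω (3 * (N : ℤ) + 3), ∀ j, |x j| ≤ (k + 7 * N + 7 : ℕ) := by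
      rintro x (hx | hx) j
      · exact hwinS x hx j
      · exact hwinH x hx j
    set E : Set (BondConfig (Site 3)) := reachEvent (withinGraph (zdGraph 3) S) b {x | x 1 = T} ∩
      reachEvent (withinGraph (zdGraph 3) (shallowReg k Ω (3 * (N : ℤ) + 3))) Ω {x | x 2 = 3 * (N : ℤ) + 3} with hE
    have hSfin : S.Finite := (boxSet_finite _).subset (subset_boxSet_of_abs_le fun x hx => hM x (Or.inl hx))
    have hprobS : α₄ ≤ (bondPercolation (zdGraph 3) p').real (reachEvent (withinGraph (zdGraph 3) S) b {x | x 1 = T}) :=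
      le_real_of_subset (percolatesVia_subset_reachEvent_le (self_mem_steepSet4 hb) 1 (by omega)
        (by simpa [hS_def] using hSfin)) (harm₄ σ hσ b hb)
    have hprobH : A.α ≤ (bondPercolation (zdGraph 3) p').real
        (reachEvent (withinGraph (zdGraph 3) (shallowReg k Ω (3 * (N : ℤ) + 3))) Ω {x | x 2 = 3 * (N : ℤ) + 3}) :=
      le_real_of_subset (percolatesVia_subset_reachEvent_le (self_mem_shallowSet hΩslab) 2 (by rw [hΩ2]; omega)
        (by simpa only [HalfSlabUniq.shallowReg] using shallowReg_finite (k := k) Ω (3 * (N : ℤ) + 3))) (A.shallow_arm Ω hΩslab)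
    refine ⟨E, (isUpperSet_reachEvent _ _ _).inter (isUpperSet_reachEvent _ _ _),
      (measurableSet_reachEvent _ _ _).inter (measurableSet_reachEvent _ _ _), ?_, ?_, fun ω hω => ?_⟩
    · exact ((determinedBy_reachEvent _ _ _).mono (edgeSet_withinGraph_subset_edgesIn (subset_boxSet_of_abs_le fun x hx =>
        hM x (Or.inl hx)))).inter ((determinedBy_reachEvent _ _ _).mono (edgeSet_withinGraph_subset_edgesIn
          (subset_boxSet_of_abs_le fun x hx => hM x (Or.inr hx))))
    · exact harris2_of_le p' (isUpperSet_reachEvent _ _ _) (isUpperSet_reachEvent _ _ _) (measurableSet_reachEvent _ _ _)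
        (measurableSet_reachEvent _ _ _) hα₄.le hprobS hprobH
    · obtain ⟨F, hFs, hFc, hFr⟩ := move_apex_cyl_region (D := {x : Site 3 | x ∈ slab 3 k ∧ (0 ≤ x 1 ∧ γ ≤ (x 1 : ℝ) + β * (x 2 : ℝ))}) (by omega)
        wdgB_cyl (S := S) (fun x hx => (hSprops x hx).1) hbS hΩslab (by rw [hΩ2]; omega) (by rw [hΩ1]; omega)
        (fun x hx => ⟨(hSD x hx).1, (hSD x hx).2, ⟨(hSprops x hx).2.1, (hSprops x hx).2.2.1⟩, hSz x hx⟩) hH hM hω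
      refine ⟨Esc ∪ F, Finset.union_subset hEsc hFs, (Finset.card_union_le _ _).trans (by omega), ?_⟩
      exact hEscMove ω (Esc ∪ F) Finset.subset_union_left (openConnVia_mono_finset Finset.subset_union_right hFr)
  have hwu : ∀ j, |u j| ≤ (k + 7 * N + 7 : ℕ) := abs_le_of_mem_boxSet hu (by omega)
  rcases hface with htop | hright | ⟨hleft, hleft'⟩
  · -- TOP face: escape `u → u + e₁ → u + e₁ + e₂`, thin steep arm leaning `+e₂`
    set m : Site 3 := u + Pi.single 1 1 with hm_def
    set b : Site 3 := m + Pi.single 2 1 with hb_def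
    have hm0 : m 0 = u 0 := by simp [hm_def]
    have hm1 : m 1 = u 1 + 1 := by simp [hm_def]
    have hm2 : m 2 = u 2 := by simp [hm_def]
    have hb0 : b 0 = u 0 := by simp [hb_def, hm0]
    have hb1 : b 1 = u 1 + 1 := by simp [hb_def, hm1]
    have hb2 : b 2 = u 2 + 1 := by simp [hb_def, hm2]
    rw [htop] at huP'; push_cast at huP'
    have hmP : m ∈ {x : Site 3 | x ∈ slab 3 k ∧ (0 ≤ x 1 ∧ γ ≤ (x 1 : ℝ) + β * (x 2 : ℝ))} :=
      ⟨by show 0 ≤ m 0 ∧ m 0 ≤ (k : ℤ); rw [hm0]; exact hu0, by rw [hm1]; omega, by rw [hm1, hm2, htop]; push_cast; linarith⟩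
    have hbP : b ∈ {x : Site 3 | x ∈ slab 3 k ∧ (0 ≤ x 1 ∧ γ ≤ (x 1 : ℝ) + β * (x 2 : ℝ))} :=
      ⟨by show 0 ≤ b 0 ∧ b 0 ≤ (k : ℤ); rw [hb0]; exact hu0, by rw [hb1]; omega, by rw [hb1, hb2, htop]; push_cast; nlinarith⟩
    have hmbox : m ∉ boxSet 3 N := not_mem_boxSet_of_lt (j := 1) (by rw [hm1, abs_of_nonneg (by omega)]; omega)
    have hadj1 : (zdGraph 3).Adj u m := (zdGraph_adj_iff _ _).2 ⟨1, Or.inl rfl⟩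
    have hadj2 : (zdGraph 3).Adj m b := (zdGraph_adj_iff _ _).2 ⟨2, Or.inl rfl⟩
    have hwm : ∀ j, |m j| ≤ (k + 7 * N + 7 : ℕ) := abs_le_of_mem_boxSet (add_single_mem_boxSet hu 1) (by omega)
    have hwb : ∀ j, |b j| ≤ (k + 7 * N + 7 : ℕ) := abs_le_of_mem_boxSet (add_single_mem_boxSet (add_single_mem_boxSet hu 1) 2) (by omega)
    refine pack (Or.inl rfl) hbP.1 (by rw [hb1, htop]; omega) (by rw [hb1, htop]) (by rw [hb2, abs_le]; constructor <;> omega)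
      (fun x hx => ?_) {s(u, m), s(m, b)} ?_ (Finset.card_insert_le _ _ |>.trans (by simp)) (fun ω F hEF h => ?_)
    · obtain ⟨⟨h0, h1, h2⟩, hxT⟩ := hx
      rw [hb2, one_mul] at h1 h2; rw [hb1, htop] at h2
      have h1r : (u 2 : ℝ) + 1 ≤ (x 2 : ℝ) := by exact_mod_cast (show u 2 + 1 ≤ x 2 by omega)
      have h2r : (N : ℝ) + 1 ≤ (x 1 : ℝ) := by exact_mod_cast (show (N : ℤ) + 1 ≤ x 1 by omega)
      have e2 : β * ((u 2 : ℝ) + 1) ≤ β * (x 2 : ℝ) := mul_le_mul_of_nonneg_left h1r hβ0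
      exact ⟨⟨h0, by omega, by nlinarith⟩, not_mem_boxSet_of_lt (j := 1) (by rw [abs_of_nonneg (by omega)]; omega)⟩
    · intro e he
      rcases Finset.mem_insert.1 he with rfl | he
      · exact mem_edgesIn_of_adj hadj1 hwu hwm
      · rw [Finset.mem_singleton] at he; rw [he]; exact mem_edgesIn_of_adj hadj2 hwm hwb
    · refine openConnVia_step (dext_adj_of hadj1 huP hmP fun h' => hmbox h'.2) (hEF (Finset.mem_insert_self _ _))
        (openConnVia_step (dext_adj_of hadj2 hmP hbP fun h' => hmbox h'.1) (hEF ?_) h)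
      exact Finset.mem_insert_of_mem (Finset.mem_singleton_self _)
  · -- RIGHT face: escape `u → u + e₂`, thin steep arm leaning `+e₂`
    set b : Site 3 := u + Pi.single 2 1 with hb_def
    have hb0 : b 0 = u 0 := by simp [hb_def]
    have hb1 : b 1 = u 1 := by simp [hb_def]
    have hb2 : b 2 = u 2 + 1 := by simp [hb_def]
    rw [hright] at huP'; push_cast at huP'
    have hbP : b ∈ {x : Site 3 | x ∈ slab 3 k ∧ (0 ≤ x 1 ∧ γ ≤ (x 1 : ℝ) + β * (x 2 : ℝ))} :=
      ⟨by show 0 ≤ b 0 ∧ b 0 ≤ (k : ℤ); rw [hb0]; exact hu0, by rw [hb1]; exact hu1nn, by rw [hb1, hb2, hright]; push_cast; nlinarith⟩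
    have hbbox : b ∉ boxSet 3 N := not_mem_boxSet_of_lt (j := 2) (by rw [hb2, hright, abs_of_nonneg (by omega)]; omega)
    have hadj : (zdGraph 3).Adj u b := (zdGraph_adj_iff _ _).2 ⟨2, Or.inl rfl⟩
    have hwb : ∀ j, |b j| ≤ (k + 7 * N + 7 : ℕ) := abs_le_of_mem_boxSet (add_single_mem_boxSet hu 2) (by omega)
    refine pack (Or.inl rfl) hbP.1 (by rw [hb1]; omega) (by rw [hb1]; omega) (by rw [hb2, hright]; exact abs_le.2 ⟨by omega, by omega⟩)
      (fun x hx => ?_) {s(u, b)} ?_ (by simp) (fun ω F hEF h => ?_)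
    · obtain ⟨⟨h0, h1, h2⟩, hxT⟩ := hx
      rw [hb2, hright, one_mul] at h1 h2; rw [hb1] at h2
      have h1r : (N : ℝ) + 1 ≤ (x 2 : ℝ) := by exact_mod_cast (show (N : ℤ) + 1 ≤ x 2 by omega)
      have h2r : (u 1 : ℝ) ≤ (x 1 : ℝ) := by exact_mod_cast (show u 1 ≤ x 1 by omega)
      have e2 : β * ((N : ℝ) + 1) ≤ β * (x 2 : ℝ) := mul_le_mul_of_nonneg_left h1r hβ0
      exact ⟨⟨h0, by omega, by nlinarith⟩, not_mem_boxSet_of_lt (j := 2) (by rw [abs_of_nonneg (by omega)]; omega)⟩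
    · intro e he
      rw [Finset.mem_singleton] at he; rw [he]; exact mem_edgesIn_of_adj hadj hwu hwb
    · exact openConnVia_step (dext_adj_of hadj huP hbP fun h' => hbbox h'.2) (hEF (Finset.mem_singleton_self _)) h
  · -- LEFT face (`γ ≤ u₁ − β(N+1)`): escape `u → u − e₂`, thin steep arm leaning `−e₂`
    set b : Site 3 := u - Pi.single 2 1 with hb_def
    have hb0 : b 0 = u 0 := by simp [hb_def]
    have hb1 : b 1 = u 1 := by simp [hb_def]
    have hb2 : b 2 = u 2 - 1 := by simp [hb_def]
    have hbP : b ∈ {x : Site 3 | x ∈ slab 3 k ∧ (0 ≤ x 1 ∧ γ ≤ (x 1 : ℝ) + β * (x 2 : ℝ))} :=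
      ⟨by show 0 ≤ b 0 ∧ b 0 ≤ (k : ℤ); rw [hb0]; exact hu0, by rw [hb1]; exact hu1nn, by rw [hb1, hb2, hleft]; push_cast; linarith⟩
    have hbbox : b ∉ boxSet 3 N := not_mem_boxSet_of_lt (j := 2) (by rw [hb2, hleft, abs_of_nonpos (by omega)]; omega)
    have hadj : (zdGraph 3).Adj u b := (zdGraph_adj_iff _ _).2 ⟨2, Or.inr (by rw [hb_def, sub_add_cancel])⟩
    have hwb : ∀ j, |b j| ≤ (k + 7 * N + 7 : ℕ) := abs_le_of_mem_boxSet (sub_single_mem_boxSet hu 2) (by omega)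
    refine pack (Or.inr rfl) hbP.1 (by rw [hb1]; omega) (by rw [hb1]; omega) (by rw [hb2, hleft]; exact abs_le.2 ⟨by omega, by omega⟩)
      (fun x hx => ?_) {s(u, b)} ?_ (by simp) (fun ω F hEF h => ?_)
    · obtain ⟨⟨h0, h1, h2⟩, hxT⟩ := hx
      rw [neg_one_mul] at h1 h2; rw [hb1] at h2
      -- along the arm: `t := b₂ − x₂ ≥ 0`, `x₁ ≥ u₁ + 4t`, `x₂ = −N−1−t`, so `x₁ + βx₂ ≥ γ + (4 − β)t ≥ γ`
      have htr : (0 : ℝ) ≤ (b 2 : ℝ) - (x 2 : ℝ) := by exact_mod_cast (show (0 : ℤ) ≤ b 2 - x 2 by linarith)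
      have h2r : (u 1 : ℝ) + 4 * ((b 2 : ℝ) - (x 2 : ℝ)) ≤ (x 1 : ℝ) := by exact_mod_cast (show u 1 + 4 * (b 2 - x 2) ≤ x 1 by linarith)
      have hb2r : (b 2 : ℝ) = -(N : ℝ) - 1 := by rw [hb2, hleft]; push_cast; ring
      have e2 : β * ((b 2 : ℝ) - (x 2 : ℝ)) ≤ 1 * ((b 2 : ℝ) - (x 2 : ℝ)) := mul_le_mul_of_nonneg_right hβ1 htr
      have e4 : β * (x 2 : ℝ) = β * (b 2 : ℝ) - β * ((b 2 : ℝ) - (x 2 : ℝ)) := by ring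
      have e5 : β * (b 2 : ℝ) = -(β * ((N : ℝ) + 1)) := by rw [hb2r]; ring
      refine ⟨⟨h0, by linarith, by nlinarith⟩, not_mem_boxSet_of_lt (j := 2) ?_⟩
      rw [abs_of_nonpos (by omega)]; omega
    · intro e he
      rw [Finset.mem_singleton] at he; rw [he]; exact mem_edgesIn_of_adj hadj hwu hwb
    · exact openConnVia_step (dext_adj_of hadj huP hbP fun h' => hbbox h'.2) (hEF (Finset.mem_singleton_self _)) h

end WedgeSlabB

end Summit.CriticalPhenomena.PercolationContinuityZ3.Theorems.Transplant

end
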